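import Summits.ABC.StewartYu.PadicMultiquadratic
import Literature.NumberTheory.Transcendental.CijsouwWaldschmidt1977Steps
import HarnessLib

/-!
# Cell abc-stewartyu, WP-A3 (iv): the SIGN-FREE set-up of the `2`-descent and its rational cores

`Summits/ABC/StewartYu/DescentSetupQ.lean` — cell `abc-stewartyu` (HOME
`run/shared/lean/pub/abc-stewartyu/`, seat p3; work package WP-A3 / the "copy-port" of
`HOME/plan/PORT-MAP.md` §0-ERRATUM; plain definitions and theorems, no named fact).

The tree's Cijsouw–Waldschmidt 1977 / Waldschmidt 1980 development over `ℚ`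
(`Literature.NumberTheory.Transcendental.CW77`, files `CijsouwWaldschmidt1977{Setup,Steps}.lean`,
`Waldschmidt1980*.lean`) is written on `CW77.Setup`, whose generators `αⱼ, θ` are POSITIVE
rationals (fields `α_pos`, `θ_pos`): positivity is what makes the real logarithms and the real
square roots of the archimedean proof available.  The `p`-adic port (blueprint
`HOME/p2/PADIC-CORE.md`) works with the principal-unit generators delivered by WP-M, which are
sign-normalised (`αⱼ ≡ 1 (mod p)`) and are NEGATIVE exactly when `−1 ∈ ⟨q₁, …, q_m⟩ ≤ (ℤ/p)ˣ`
(planner's FLAG F-plan-2), so `CW77.Setup` cannot be instantiated.  This file provides the sign-free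
data and the SIGNED rational cores, re-using every sign-blind object of the tree through the
"flattening" `S♭ = ⟨|α|, |θ|, b, b_θ⟩ : CW77.Setup`:

* `SetupQ` — `d` non-zero rationals `αⱼ`, a non-zero rational `θ`, integers `bⱼ`, `b_θ ≠ 0`
  (`CW77.Setup` with `α_pos/θ_pos` weakened to `α_ne/θ_ne`; NO `p`-adic field: the `p`-adic data
  of WP-A2 are a `SetupQ` plus `p` and `ord_p(αⱼ − 1) ≥ 1`); `SetupQ.flat = S♭`;
* sign-blind objects are those of `S♭`, used as `Q.flat.qΔ`, `Q.flat.qA`, `Q.flat.γ`, `Q.flat.box`,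
  `Q.flat.reidx`, `Q.flat.halve`, `Q.flat.expn`, `Q.flat.Sset`, `Q.flat.Dclear`, `Q.flat.Dhalf`, …
  (they depend on the generators only through `d`, `b`, `b_θ` and the denominators);
* SIGNED objects (this file): `all = (α, θ)`, `qE = ∏ αⱼ^{λⱼ s} θ^{λ_θ s}`, `qTerm = qΔ · qA · qE`,
  `coreSum = ∑ p(u) qTerm`, `qEh = ∏ allᵢ^{⌊expnᵢ/2⌋}`, `rHalf = qΔ_{J+1} · qA · qEh`, the class sums
  `classVec`, `Kfac`; and the bridges `|qE| = qE♭`, `|qEh| = qEh♭`, `|qTerm| = |qTerm♭|`,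
  `|rHalf| = |rHalf♭|` by which every archimedean SIZE estimate of the tree (`Waldschmidt1980Sizes*`)
  transfers verbatim;
* the re-indexing identities `qEh_reidx`, `rHalf_reidx` (proofs of the tree verbatim);
* **the place-free half-point identity** (`prod_root_pow_expn`, `sum_half_eq_evL_classVec`): in ANY
  field `L` of characteristic `0` with chosen square roots `rᵢ² = allᵢ`,
  `∏ᵢ rᵢ^{expnᵢ(u,s)} = qEh(u,s) · ∏_{i ∈ Sset(u,s)} rᵢ` and hence
  `∑_u p(u) · c(u) · ∏ᵢ rᵢ^{expnᵢ} = evL r (class sums of p·c)` — the algebraic content of the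
  tree's `CW77.Setup.cexp_ψ_half` / `Φ_half` (there `L = ℝ ⊂ ℂ`, `rᵢ = √allᵢ`); `p`-adically
  `L = ℚ_p` and `rᵢ = psqrt(allᵢ)` (`PadicPrincipalUnitSqrt.lean`).

Nothing here is claimed to be in print; the objects are those of [CijsouwWaldschmidt1977, §4] with
signs allowed.  Everything is [folklore].
-/

noncomputable section

open Finset
open Literature.NumberTheory.Transcendental
open Literature.NumberTheory.Transcendental.CW77
open Literature.NumberTheory.Transcendental.CW77.Setup (Idx Tau tauNorm scale)

namespace Summit.ABC.StewartYu

/-- **The sign-free data of the `2`-descent**: `d` non-zero rationals `αⱼ`, the eliminated non-zero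
rational `θ`, and the integer coefficients `bⱼ`, `b_θ ≠ 0` of the linear form
`∑ bⱼ log αⱼ + b_θ log θ` (`CW77.Setup` without positivity). [folklore] -/
structure SetupQ where
  /-- the number of free generators -/
  d : ℕ
  /-- the free generators -/
  α : Fin d → ℚ
  /-- the eliminated generator -/
  θ : ℚ
  /-- non-vanishing -/
  α_ne : ∀ j, α j ≠ 0
  /-- non-vanishing -/
  θ_ne : θ ≠ 0
  /-- the coefficients of the free logarithms -/
  b : Fin d → ℤ
  /-- the coefficient of `log θ` -/
  bθ : ℤ
  /-- it is non-zero -/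
  bθ_ne : bθ ≠ 0

namespace SetupQ

variable (Q : SetupQ) {h Lb : ℕ}

/-! ### The flattening `S♭ = ⟨|α|, |θ|⟩` and the signed generators -/

/-- The flattened POSITIVE set-up `S♭ = ⟨d, |α|, |θ|, b, b_θ⟩ : CW77.Setup`; all sign-blind objects of
the descent are taken from it. [folklore] -/
abbrev flat : CW77.Setup where
  d := Q.d
  α := fun j => |Q.α j|
  θ := |Q.θ|
  α_pos := fun j => abs_pos.mpr (Q.α_ne j)
  θ_pos := abs_pos.mpr Q.θ_ne
  b := Q.b
  bθ := Q.bθ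
  bθ_ne := Q.bθ_ne

/-- All `d + 1` signed generators: `αⱼ` (`j < d`) and `θ` (last). [folklore] -/
def all : Fin (Q.d + 1) → ℚ := Fin.snoc Q.α Q.θ

/-- The signed generators are non-zero. [folklore] -/
theorem all_ne (i : Fin (Q.d + 1)) : Q.all i ≠ 0 := by
  unfold all
  refine Fin.lastCases ?_ (fun j => ?_) i
  · rw [Fin.snoc_last]; exact Q.θ_ne
  · rw [Fin.snoc_castSucc]; exact Q.α_ne j

/-- `all♭ᵢ = |allᵢ|`. [folklore] -/
theorem flat_all (i : Fin (Q.d + 1)) : Q.flat.all i = |Q.all i| := by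
  unfold CW77.Setup.all all
  refine Fin.lastCases ?_ (fun j => ?_) i
  · simp only [Fin.snoc_last]
  · simp only [Fin.snoc_castSucc]

/-- Components of `expn♭` (restated with `Q.d` in the index type, for rewriting). [folklore] -/
@[simp] theorem flat_expn_castSucc (u : Idx Q.d h Lb) (s : ℕ) (j : Fin Q.d) :
    Q.flat.expn u s (Fin.castSucc j) = u.2.1 j * s := CW77.Setup.expn_castSucc Q.flat u s j

/-- Components of `expn♭`. [folklore] -/
@[simp] theorem flat_expn_last (u : Idx Q.d h Lb) (s : ℕ) : Q.flat.expn u s (Fin.last Q.d) = u.2.2 * s :=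
  CW77.Setup.expn_last Q.flat u s

/-- Components of `resVec♭`. [folklore] -/
@[simp] theorem flat_resVec_castSucc (ε : Fin Q.d → ℕ) (εθ : ℕ) (j : Fin Q.d) :
    Q.flat.resVec ε εθ (Fin.castSucc j) = ε j := CW77.Setup.resVec_castSucc Q.flat ε εθ j

/-- Components of `resVec♭`. [folklore] -/
@[simp] theorem flat_resVec_last (ε : Fin Q.d → ℕ) (εθ : ℕ) : Q.flat.resVec ε εθ (Fin.last Q.d) = εθ :=
  CW77.Setup.resVec_last Q.flat ε εθ

/-- Components of `reidx♭`. [folklore] -/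
@[simp] theorem flat_reidx_fst (ε : Fin Q.d → ℕ) (εθ : ℕ) (v : Idx Q.d h Lb) :
    (Q.flat.reidx ε εθ v).1 = v.1 := rfl

/-- Components of `reidx♭`. [folklore] -/
@[simp] theorem flat_reidx_snd_fst (ε : Fin Q.d → ℕ) (εθ : ℕ) (v : Idx Q.d h Lb) (j : Fin Q.d) :
    (Q.flat.reidx ε εθ v).2.1 j = ε j + 2 * v.2.1 j := rfl

/-- Components of `reidx♭`. [folklore] -/
@[simp] theorem flat_reidx_snd_snd (ε : Fin Q.d → ℕ) (εθ : ℕ) (v : Idx Q.d h Lb) :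
    (Q.flat.reidx ε εθ v).2.2 = εθ + 2 * v.2.2 := rfl

/-! ### The signed rational cores at the natural points -/

/-- `qE(u, s) = ∏ⱼ αⱼ^{λⱼ s} · θ^{λ_θ s}` (signed). [folklore] -/
def qE (u : Idx Q.d h Lb) (s : ℕ) : ℚ := (∏ j, Q.α j ^ (u.2.1 j * s)) * Q.θ ^ (u.2.2 * s)

/-- `qE = ∏ᵢ allᵢ^{expnᵢ}` over all `d + 1` generators. [folklore] -/
theorem qE_eq_prod_all (u : Idx Q.d h Lb) (s : ℕ) : Q.qE u s = ∏ i, Q.all i ^ Q.flat.expn u s i := by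
  unfold qE all CW77.Setup.expn
  rw [Fin.prod_univ_castSucc]
  simp only [Fin.snoc_castSucc, Fin.snoc_last]

/-- `qE ≠ 0`. [folklore] -/
theorem qE_ne (u : Idx Q.d h Lb) (s : ℕ) : Q.qE u s ≠ 0 := by
  rw [Q.qE_eq_prod_all]
  exact prod_ne_zero_iff.mpr fun i _ => pow_ne_zero _ (Q.all_ne i)

/-- **Bridge**: `|qE(u,s)| = qE♭(u,s)`. [folklore] -/
theorem abs_qE (u : Idx Q.d h Lb) (s : ℕ) : |Q.qE u s| = Q.flat.qE u s := by
  unfold qE CW77.Setup.qE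
  rw [abs_mul, abs_prod]
  simp only [abs_pow]

/-- `qE♭ > 0`. [folklore] -/
theorem flat_qE_pos (u : Idx Q.d h Lb) (s : ℕ) : 0 < Q.flat.qE u s := by
  unfold CW77.Setup.qE
  exact mul_pos (prod_pos fun j _ => pow_pos (Q.flat.α_pos j) _) (pow_pos Q.flat.θ_pos _)

/-- `qEh♭ > 0`. [folklore] -/
theorem flat_qEh_pos (u : Idx Q.d h Lb) (s : ℕ) : 0 < Q.flat.qEh u s := by
  unfold CW77.Setup.qEh
  exact prod_pos fun i _ => pow_pos (Q.flat.all_pos i) _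

/-- The signed rational core of one term at a natural point: `qΔ♭ · qA♭ · qE`. [folklore] -/
def qTerm (J₀ J : ℕ) (u : Idx Q.d h Lb) (τ : Tau Q.d) (s : ℕ) : ℚ :=
  Q.flat.qΔ J₀ J u τ.1 s * Q.flat.qA u τ.2 * Q.qE u s

/-- **Bridge**: `|qTerm| = |qTerm♭|`. [folklore] -/
theorem abs_qTerm (J₀ J : ℕ) (u : Idx Q.d h Lb) (τ : Tau Q.d) (s : ℕ) :
    |Q.qTerm J₀ J u τ s| = |Q.flat.qTerm J₀ J u τ s| := by
  unfold qTerm CW77.Setup.qTerm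
  rw [abs_mul, abs_mul, Q.abs_qE, abs_mul, abs_mul, abs_of_pos (Q.flat_qE_pos u s)]

/-- **The signed rational core of `φ_{J,τ}(s)`**: `coreSum = ∑_u p(u) · qTerm`. [folklore] -/
def coreSum (J₀ J : ℕ) (box : Finset (Idx Q.d h Lb)) (p : Idx Q.d h Lb → ℤ) (τ : Tau Q.d) (s : ℕ) : ℚ :=
  ∑ u ∈ box, (p u : ℚ) * Q.qTerm J₀ J u τ s

/-! ### The signed rational cores at the half points -/

/-- The rational part `qEh = ∏ᵢ allᵢ^{⌊expnᵢ/2⌋}` of the value at `s/2` (signed). [folklore] -/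
def qEh (u : Idx Q.d h Lb) (s : ℕ) : ℚ := ∏ i, Q.all i ^ (Q.flat.expn u s i / 2)

/-- `qEh ≠ 0`. [folklore] -/
theorem qEh_ne (u : Idx Q.d h Lb) (s : ℕ) : Q.qEh u s ≠ 0 :=
  prod_ne_zero_iff.mpr fun i _ => pow_ne_zero _ (Q.all_ne i)

/-- **Bridge**: `|qEh(u,s)| = qEh♭(u,s)`. [folklore] -/
theorem abs_qEh (u : Idx Q.d h Lb) (s : ℕ) : |Q.qEh u s| = Q.flat.qEh u s := by
  unfold qEh CW77.Setup.qEh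
  rw [abs_prod]
  refine prod_congr rfl fun i _ => ?_
  rw [abs_pow, Q.flat_all]

/-- The signed coefficient of one unknown at `s/2`: `rHalf = qΔ♭_{J+1} · qA♭ · qEh`. [folklore] -/
def rHalf (J₀ J : ℕ) (u : Idx Q.d h Lb) (τ : Tau Q.d) (s : ℕ) : ℚ :=
  Q.flat.qΔ J₀ (J + 1) u τ.1 s * Q.flat.qA u τ.2 * Q.qEh u s

/-- **Bridge**: `|rHalf| = |rHalf♭|`. [folklore] -/
theorem abs_rHalf (J₀ J : ℕ) (u : Idx Q.d h Lb) (τ : Tau Q.d) (s : ℕ) :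
    |Q.rHalf J₀ J u τ s| = |Q.flat.rHalf J₀ J u τ s| := by
  unfold rHalf CW77.Setup.rHalf
  rw [abs_mul, abs_mul, Q.abs_qEh, abs_mul, abs_mul]
  congr 1
  exact (abs_of_pos (Q.flat_qEh_pos u s)).symm

/-- **The signed class sums**: the coefficient of the monomial `∏_{i∈T'} rᵢ` in the value at `s/2`.
[folklore] -/
def classVec (J₀ J : ℕ) (box : Finset (Idx Q.d h Lb)) (p : Idx Q.d h Lb → ℤ) (τ : Tau Q.d) (s : ℕ)
    (T' : Finset (Fin (Q.d + 1))) : ℚ :=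
  ∑ u ∈ box with Q.flat.Sset u s = T', (p u : ℚ) * Q.rHalf J₀ J u τ s

/-- `∑_{T'} |classVec(T')| ≤ ∑_u |p(u)| |rHalf(u)|`. [folklore] -/
theorem sum_abs_classVec_le (J₀ J : ℕ) (box : Finset (Idx Q.d h Lb)) (p : Idx Q.d h Lb → ℤ)
    (τ : Tau Q.d) (s : ℕ) :
    ∑ T', |(Q.classVec J₀ J box p τ s T' : ℝ)| ≤ ∑ u ∈ box, |(p u : ℝ)| * |(Q.rHalf J₀ J u τ s : ℝ)| := by
  classical
  unfold classVec
  push_cast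
  calc ∑ T', |∑ u ∈ box with Q.flat.Sset u s = T', (p u : ℝ) * (Q.rHalf J₀ J u τ s : ℝ)|
      ≤ ∑ T', ∑ u ∈ box with Q.flat.Sset u s = T', |(p u : ℝ) * (Q.rHalf J₀ J u τ s : ℝ)| :=
        sum_le_sum fun T' _ => abs_sum_le_sum_abs _ _
    _ = ∑ u ∈ box, |(p u : ℝ) * (Q.rHalf J₀ J u τ s : ℝ)| :=
        Finset.sum_fiberwise box (fun u => Q.flat.Sset u s) _
    _ = ∑ u ∈ box, |(p u : ℝ)| * |(Q.rHalf J₀ J u τ s : ℝ)| := sum_congr rfl fun u _ => abs_mul _ _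

/-! ### The effect of the re-indexing `λ = λ⁰ + 2μ` on the signed coefficients -/

/-- The constant factor `Kfac = ∏ᵢ allᵢ^{⌊εᵢ s/2⌋}` pulled out of `qEh` (signed). [folklore] -/
def Kfac (ε : Fin Q.d → ℕ) (εθ s : ℕ) : ℚ := ∏ i : Fin (Q.d + 1), Q.all i ^ (Q.flat.resVec ε εθ i * s / 2)

/-- `Kfac ≠ 0`. [folklore] -/
theorem Kfac_ne (ε : Fin Q.d → ℕ) (εθ s : ℕ) : Q.Kfac ε εθ s ≠ 0 :=
  prod_ne_zero_iff.mpr fun i _ => pow_ne_zero _ (Q.all_ne i)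

/-- **`qEh(reidx v, s) = Kfac · qE(v, s)`** (`((ε + 2μ)s)/2 = (εs)/2 + μs`). [folklore] -/
theorem qEh_reidx (ε : Fin Q.d → ℕ) (εθ : ℕ) (v : Idx Q.d h Lb) (s : ℕ) :
    Q.qEh (Q.flat.reidx ε εθ v) s = Q.Kfac ε εθ s * Q.qE v s := by
  unfold qEh Kfac qE
  rw [Fin.prod_univ_castSucc, Fin.prod_univ_castSucc]
  simp only [flat_expn_castSucc, flat_expn_last, flat_resVec_castSucc, flat_resVec_last,
    flat_reidx_snd_fst, flat_reidx_snd_snd]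
  unfold all
  simp only [Fin.snoc_castSucc, Fin.snoc_last]
  have hsplit : ∀ (a : ℚ) (e m : ℕ), a ^ ((e + 2 * m) * s / 2) = a ^ (e * s / 2) * a ^ (m * s) := by
    intro a e m
    rw [← pow_add]; congr 1
    rw [show (e + 2 * m) * s = e * s + 2 * (m * s) by ring, Nat.add_mul_div_left _ _ two_pos]
  simp_rw [hsplit]
  rw [prod_mul_distrib]
  ring

/-- **`rHalf(reidx v) = (2^{|τ'|} Kfac) · qΔ♭_{J+1}(v) qE(v) · ∏ (γ♭ⱼ(v) + cⱼ)^{τ'ⱼ}`.** [folklore] -/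
theorem rHalf_reidx (J₀ J : ℕ) (ε : Fin Q.d → ℕ) (εθ : ℕ) (v : Idx Q.d h Lb) (τ : Tau Q.d) (s : ℕ) :
    Q.rHalf J₀ J (Q.flat.reidx ε εθ v) τ s =
      (2 ^ (∑ j, τ.2 j) * Q.Kfac ε εθ s) *
        ((Q.flat.qΔ J₀ (J + 1) v τ.1 s * Q.qE v s) * ∏ j, (Q.flat.γ v j + Q.flat.cγ ε εθ j) ^ τ.2 j) := by
  unfold rHalf
  rw [Q.flat.qΔ_reidx, Q.qEh_reidx, Q.flat.qA_reidx]
  ring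

/-! ### The place-free half-point identity -/

section HalfPoint

variable {L : Type*} [Field L] [CharZero L]

omit [CharZero L] in
/-- `r^n = (r·r)^{⌊n/2⌋} · (r if n is odd, else 1)`. [folklore] -/
theorem pow_eq_pow_div_two_mul (r : L) (n : ℕ) :
    r ^ n = (r * r) ^ (n / 2) * (if n % 2 = 1 then r else 1) := by
  rw [← sq, ← pow_mul]
  conv_lhs => rw [← Nat.div_add_mod n 2, pow_add]
  rcases Nat.mod_two_eq_zero_or_one n with h0 | h1
  · rw [h0, if_neg (by omega), pow_zero]
  · rw [h1, if_pos rfl, pow_one]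

/-- **`∏ᵢ rᵢ^{expnᵢ(u,s)} = qEh(u,s) · ∏_{i ∈ Sset(u,s)} rᵢ`** for square roots `rᵢ² = allᵢ` in any
field of characteristic zero (the algebraic content of `CW77.Setup.cexp_ψ_half`). [folklore] -/
theorem prod_root_pow_expn (r : Fin (Q.d + 1) → L) (hr : ∀ i, r i * r i = (Q.all i : L))
    (u : Idx Q.d h Lb) (s : ℕ) :
    ∏ i, r i ^ Q.flat.expn u s i = (Q.qEh u s : L) * Multiquad.monoL r (Q.flat.Sset u s) := by
  unfold qEh Multiquad.monoL CW77.Setup.Sset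
  rw [Rat.cast_prod, Finset.prod_filter, ← prod_mul_distrib]
  refine prod_congr rfl fun i _ => ?_
  rw [pow_eq_pow_div_two_mul (r i), hr i, Rat.cast_pow]

/-- **The value at a half point is the evaluation of the class sums**: for any rational weights
`c(u)`, `∑_{u ∈ box} p(u) c(u) ∏ᵢ rᵢ^{expnᵢ(u,s)} = evL r (T' ↦ ∑_{u : Sset u s = T'} p(u) c(u) qEh(u,s))`
(the algebraic content of `CW77.Setup.Φ_half`). [folklore] -/
theorem sum_prod_root_pow_eq_evL (r : Fin (Q.d + 1) → L) (hr : ∀ i, r i * r i = (Q.all i : L))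
    (box : Finset (Idx Q.d h Lb)) (p : Idx Q.d h Lb → ℤ) (c : Idx Q.d h Lb → ℚ) (s : ℕ) :
    ∑ u ∈ box, (p u : L) * (c u : L) * ∏ i, r i ^ Q.flat.expn u s i =
      Multiquad.evL r (fun T' => ∑ u ∈ box with Q.flat.Sset u s = T', (p u : ℚ) * (c u * Q.qEh u s)) := by
  classical
  unfold Multiquad.evL
  have hfib : ∑ u ∈ box, (p u : L) * (c u : L) * ∏ i, r i ^ Q.flat.expn u s i =
      ∑ u ∈ box, ((p u : ℚ) * (c u * Q.qEh u s) : ℚ) * Multiquad.monoL r (Q.flat.Sset u s) := by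
    refine sum_congr rfl fun u _ => ?_
    rw [Q.prod_root_pow_expn r hr]; push_cast; ring
  rw [hfib, ← Finset.sum_fiberwise box (fun u => Q.flat.Sset u s)
    (fun u => (((p u : ℚ) * (c u * Q.qEh u s) : ℚ) : L) * Multiquad.monoL r (Q.flat.Sset u s))]
  refine sum_congr rfl fun T' _ => ?_
  rw [Rat.cast_sum, sum_mul]
  refine sum_congr rfl fun u hu => ?_
  rw [(Finset.mem_filter.mp hu).2]

/-- **`∑_u p(u) · (qΔ♭_{J+1} qA♭)(u) · ∏ᵢ rᵢ^{expnᵢ(u,s)} = evL r (classVec_{J,τ,s})`** — the form in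
which the `p`-adic function layer meets the class sums (`c(u) = qΔ♭_{J+1}(u) qA♭(u)`). [folklore] -/
theorem sum_half_eq_evL_classVec (r : Fin (Q.d + 1) → L) (hr : ∀ i, r i * r i = (Q.all i : L))
    (J₀ J : ℕ) (box : Finset (Idx Q.d h Lb)) (p : Idx Q.d h Lb → ℤ) (τ : Tau Q.d) (s : ℕ) :
    ∑ u ∈ box, (p u : L) * ((Q.flat.qΔ J₀ (J + 1) u τ.1 s * Q.flat.qA u τ.2 : ℚ) : L) *
        ∏ i, r i ^ Q.flat.expn u s i =
      Multiquad.evL r (Q.classVec J₀ J box p τ s) := by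
  rw [Q.sum_prod_root_pow_eq_evL r hr]
  unfold classVec rHalf
  rfl

end HalfPoint

end SetupQ

end Summit.ABC.StewartYu

end
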